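import Literature.MathematicalPhysics.QuantumFieldTheory.Balaban1983to89.B8SockP5uEAssemblyBGamma
import Literature.MathematicalPhysics.QuantumFieldTheory.Balaban1983to89.B8LeafModelZdSockP5uEGamma

/-!
# `Balaban1983to89.B8SockP5uEProviderGamma` — [Balaban1985RegularSpaces] Prop. 5 (1.109) p. 94 with Thm 4 p. 88/p. 95: THE PROVIDER of the repaired
# Proposition-5 UNIQUENESS socket IN EDITION γ (`B8LeafModelZdSockP5uEGamma.SockP5uEγ`) FROM THE GUARDED UNIQUENESS-LETTERS FAMILY and the b9 socket
# over PRINT's crossing-bond class — dag-n05-d's `sockP5uE_of_lettersUB` ∕ `exists_threshold_sockP5uEB` re-run on the γ body, with the γ windows from ONE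
# threshold

statement-level skeleton of published theorems with citation tags; proofs where landed; nothing here is a claim about the Yang–Mills mass gap

T. Bałaban, *Spaces of regular gauge field configurations on a lattice and gauge fixing conditions*, Commun. Math. Phys. **99** (1985) 75–102
`[Balaban1985RegularSpaces]` ("B8"; printed page = PDF page + 74): Prop. 5 (1.107)–(1.109) p. 94 («There exist positive constants c₂, c₃, depending on d
and L only»), Thm 4 p. 88, p. 95, (1.31) + (1.35) p. 82, p. 77, Prop. 3 p. 87 («α₀, α₁, α₂ bounded by a constant depending on d and L only»), (1.61) p. 86;
[3] = [Balaban1985Averaging] Prop. 4 p. 38; [4] = [Balaban1985BackgroundPropagators] Thm 3.1 p. 397, Thm 3.3 p. 398.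
PDF held: `paper:balaban1985-cmp99-regular-spaces-gauge-fixing`.  STATUS: published, refereed.

CITATION HEADER (lean-in-tree rule).  Cell `pub-ymgap` (YM Track A, DAG node N05 = [B8], HUMAN RULING D-0062 ∕ D-0149 width seats), seat
`pub-ymgap-dag-n05-w4` (g0): W-SEAT-START-LIST v3 §n05 item 4 («the Prop-5 sockets ∕ `SockP5u′`, m ≥ 1 obligation», director-ym №194a OPEN-OBLIGATION note).
WHY THIS FILE.  `B8SockP5uEAssemblyBGamma.sockP5uE_body_of_join_b_γ` is the provider BODY of the uniqueness socket under print's box law «box ⊂ Ω_{j−1}»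
for the b9 socket's class and (1.35) in print's p. 77 guard; `B8LeafModelZdSockP5uEGamma.SockP5uEγ` is the socket text with that guard (LOCATED-SOCK135).
THIS FILE assembles the two exactly as dag-n05-d's `B8SockP5uEAssemblyB` §2 assembles the «box ⊂ Ω_j» edition:
* §1 `gammaWindows_of_guard` — print's «constants depending on d and L only» for the FIVE γ windows the body asks beyond dag-n04-b's 29-window family
  `B8SockP5uEWindows.uniqWindows_of_guard`: ONE threshold `c_γ(d, L, B₀) > 0` on `α₀ + α₁` giving, at `c⋆ = 5dLB₀(α₀ + α₁)`, `c_B = L·c⋆`: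
  `C₀·L²α₀ ≤ 1/3`, `4L²α₀ ≤ c₂′`, `e^{4c·L²α₀}(1 + 8C₁c_B) ≤ 2`, `8C₁e^{4c·L²α₀}L² ≤ 16C₁L²`, and (1.61) with `C₂ = 16C₁L²` (real arithmetic only).
* §2 ★ `sockP5uEγ_of_lettersUB` — `SockP5uEγ` AT ONE `Ω 0 = univ` MEMBER from (i) the guarded uniqueness-letters family `SLetUB` at the top structure, (ii) the b9
  socket `SB9all` at every truncation over the PARAMETRIC class `Λb` (law «box ⊂ Ω_{j−1}» + `hclass`), (iii) dag-n04-b's windows family `hwin` below `c_P` at a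
  fixed radius `α₄`, socket radius `c_u`, and (iv) the γ windows family `hwinγ` below `c_P` — dag-n05-d's `sockP5uE_of_lettersUB` signature + (iv), body γ.
* §3 ★ `exists_threshold_sockP5uEγB` — print's «c₂, c₃»: ONE radius `c_u` and ONE threshold `c_F = min(c_P, c_L, c_γ)` for the whole `Ω 0 = univ`
  sub-family (`uniqWindows_of_guard` + `gammaWindows_of_guard`).
Kind «kernel-checked proof», theorems only: no `def`, no `… : Prop` fact, no existing module modified.

HONEST SCOPE ∕ A6.  Plumbing by name + real-arithmetic windows; nothing of [4]'s letters (HYPOTHESES `SLetUB`), of [4] Thm 3.3 (the b9 socket `SB9all`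
over the PARAMETRIC class `Λb` is a HYPOTHESIS — false over a «box ⊂ Ω_j» class at nested members by dag-n05-c p572834 ∕ p576185; = print's (1.59) over
print's class `cubeLamBP'` ∕ `towerBondsP`, open, inhabited at `m = 0` by dag-n06-b's `B9SupplySockB9P3ZdGamma` witness; `m ≥ 1` = N06 content), of
Sect. E or of the contraction is proved here beyond composition.  No joint-satisfiability claim about (i)–(iv) + the member laws is made here.  `Ω 0 = univ`
sub-family; `d ≥ 2`, `L ≥ 2`.  Count-neutral; N05 NOT discharged; no count claim; one finite `𝕋⁴` programme at fixed `ε`, Bałaban as printed; the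
Yang–Mills mass gap (Clay) is NOT proved by any of this — R4 closes the conditional finite-`𝕋⁴` rung `BalabanLadder.UV` only; nothing continuum ∕ ℝ⁴ ∕ OS.
No `sorry`, no `def`, no `instance`, no `notation`.  Unit `pub-ymgap-dag-n05-w4` (g0), 2026-08-27.

RELATED IN THE TREE, NOT DUPLICATED: `B8SockP5uEAssemblyB` (dag-n05-d; «box ⊂ Ω_j» edition of §2∕§3), `B8SockP5uEAssembly` (dag-n04-b), `B8SockP5uEWindows`
(dag-n04-b; the 29-window family — USED), `B8SockP5uEAssemblyBGamma` (this seat; the body — USED), `B8LeafModelZdSockP5uEGamma` (this seat; the socket text —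
USED), `B8SockSP5uProviderSrc` ∕ `B8SockP5uEAssemblyBSrc` (dag-n05-d; sourced editions — their γ twins follow the same pattern).
-/

noncomputable section

open NormedSpace
open scoped BigOperators

namespace Literature.MathematicalPhysics.QuantumFieldTheory.Balaban1983to89.B8SockP5uEProviderGamma

open Complex (I)
open B7Prop1Explicit B7Prop2Explicit B7Prop1Local B7Eq92Concrete
open B7Prop2Explicit (C0 c2' C0_pos c2'_pos)
open B7Prop3Flat (c3)
open B7Prop10General (C6 C4G)
open B7Prop9Flat (C5')
open B7Eq78Linearization (conjR zdBlocking QprimeIter)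
open B8Ineq132 (covDerivFwd covDeriv InAk)
open B8Eq119TwistedAxial (Restr129 InAx bgT)
open B8Eq184Proof (gaugeExp cfgExp)
open B8Lemma1NonAbelian (mulCfg)
open B8Eq140Level (SideTouches)
open B8Ineq130 (tlo thi)
open B8Thm2LogB (blockTop)
open B8Eq138LandauZd (IsLandau138W covLap QT)
open B8Ineq125Concrete (C2p)
open B8Eq1117Concrete (XSpace)
open B8LeafModelZd3 (SockB9P3)
open B8Prop5ContractionKLevel (Bd2 Mc Kc)
open B8LambdaSpaceKLevel (wt)
open B8LeafModelZdSockP5uEGamma (SockP5uEγ)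
open B8SockP5uEWindows (uniqWindows_of_guard)
open B8SockP5uEAssemblyBGamma (sockP5uE_body_of_join_b_γ)

-- `Site` alone could resolve to the torus sites of `Setup.lean`; re-export the `ℤ^d` sites of `B7Prop1Explicit`.
export B7Prop1Explicit (Site)

variable {d : ℕ} {𝔸 : Type*} [CStarAlgebra 𝔸] [Nontrivial 𝔸]

/-! ## §1 The γ windows from ONE threshold `c_γ(d, L, B₀)` -/

omit [Nontrivial 𝔸] in
/-- The [3]-Prop.-4 window `e^{x}(1 + y) ≤ 2` from `0 ≤ x ≤ 1/10`, `0 ≤ y ≤ 1/2`, together with `e^{x} ≤ 2` (private plumbing, as in `B8Prop3KLevel`). [folklore] -/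
private theorem exp_window' {x y : ℝ} (hx0 : 0 ≤ x) (hx : x ≤ 1 / 10) (hy0 : 0 ≤ y) (hy : y ≤ 1 / 2) :
    Real.exp x * (1 + y) ≤ 2 ∧ Real.exp x ≤ 2 := by
  have h := Real.abs_exp_sub_one_le (x := x) (by rw [abs_of_nonneg hx0]; linarith)
  rw [abs_of_nonneg hx0] at h
  have h2 : Real.exp x ≤ 1 + 2 * x := by linarith [(abs_le.mp h).2]
  have h3 : Real.exp x ≤ 6 / 5 := by linarith
  refine ⟨?_, by linarith⟩
  calc Real.exp x * (1 + y) ≤ 6 / 5 * (1 + 1 / 2) := by gcongr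
    _ ≤ 2 := by norm_num

omit [Nontrivial 𝔸] in
/-- **THE γ WINDOWS FROM ONE THRESHOLD** (print: «α₀, α₁, α₂ bounded by a constant depending on d and L only», Prop. 3 p. 87; «c₂, c₃» Prop. 5 p. 94):
there is `c_γ = c_γ(d, L, B₀) > 0` such that for `0 < α₀, α₁` with `α₀ + α₁ ≤ c_γ`, at the JOIN's exponent bound `c⋆ = 5dLB₀(α₀ + α₁)` and `c_B = L·c⋆`,
the five windows that the edition-γ body `sockP5uE_body_of_join_b_γ` asks beyond dag-n04-b's family hold: the [3]-Prop.-4 windows ONE LEVEL LOWER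
`C₀·L²α₀ ≤ 1/3`, `4L²α₀ ≤ c₂′`, `e^{4c·L²α₀}(1 + 8C₁c_B) ≤ 2`, the (1.56) remainder-constant majorant `8C₁e^{4c·L²α₀}L² ≤ 16C₁L²`, and (1.61) with
`C₂ = 16C₁L²`.  Real arithmetic only (`c_γ = min 1/(Dᵢ + 1)` over five explicit coefficients). [cite: Balaban1985RegularSpaces, Prop. 3 p.87, (1.61) p.86, Prop. 5 p.94; Balaban1985Averaging, Prop. 4 p.38] -/
theorem gammaWindows_of_guard (hd : 1 ≤ d) {L : ℕ} (hL : 1 ≤ L) {B₀ : ℝ} (hB₀ : 0 < B₀) :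
    ∃ cγ : ℝ, 0 < cγ ∧ ∀ α₀ α₁ : ℝ, 0 < α₀ → 0 < α₁ → α₀ + α₁ ≤ cγ →
      ∀ cs cB : ℝ, cs = 5 * (d : ℝ) * L * B₀ * (α₀ + α₁) → cB = L * cs →
      C0 d * ((L : ℝ) ^ 2 * α₀) ≤ 1 / 3 ∧ 4 * ((L : ℝ) ^ 2 * α₀) ≤ c2' d L ∧
      Real.exp (4 * (800 * ((d : ℝ) + 1) ^ 2 * ((d : ℝ) + 4)) * ((L : ℝ) ^ 2 * α₀)) * (1 + 8 * (131072 * ((d : ℝ) + 1) ^ 2) * cB) ≤ 2 ∧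
      8 * (131072 * ((d : ℝ) + 1) ^ 2) * Real.exp (4 * (800 * ((d : ℝ) + 1) ^ 2 * ((d : ℝ) + 4)) * ((L : ℝ) ^ 2 * α₀)) * (L : ℝ) ^ 2
        ≤ 16 * (131072 * ((d : ℝ) + 1) ^ 2) * (L : ℝ) ^ 2 ∧
      2 * cs ^ 2 + 20 * d * α₀ * cs + 2 * (16 * (131072 * ((d : ℝ) + 1) ^ 2) * (L : ℝ) ^ 2) * cs ^ 2 ≤ α₀ + α₁ := by
  have hd' : (1 : ℝ) ≤ d := by exact_mod_cast hd
  have hL' : (1 : ℝ) ≤ L := by exact_mod_cast hL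
  have hd0 : (0 : ℝ) < d := by linarith only [hd']
  have hL0 : (0 : ℝ) < L := by linarith only [hL']
  have hC0 : 0 < C0 d := C0_pos d
  have hc2 : 0 < c2' d L := c2'_pos d L hL
  -- scales
  obtain ⟨K₁, hK₁⟩ : ∃ K₁ : ℝ, K₁ = 5 * d * L * B₀ := ⟨_, rfl⟩
  have hK₁0 : 0 < K₁ := by rw [hK₁]; positivity
  obtain ⟨cc, hcc⟩ : ∃ cc : ℝ, cc = 800 * ((d : ℝ) + 1) ^ 2 * ((d : ℝ) + 4) := ⟨_, rfl⟩
  have hcc0 : 0 < cc := by rw [hcc]; positivity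
  obtain ⟨C₁, hC₁⟩ : ∃ C₁ : ℝ, C₁ = 131072 * ((d : ℝ) + 1) ^ 2 := ⟨_, rfl⟩
  have hC₁0 : 0 < C₁ := by rw [hC₁]; positivity
  -- the five coefficients: `Dᵢ·S ≤ 1`
  obtain ⟨E1, hE1⟩ : ∃ E1 : ℝ, E1 = 3 * C0 d * (L : ℝ) ^ 2 := ⟨_, rfl⟩
  obtain ⟨E2, hE2⟩ : ∃ E2 : ℝ, E2 = 4 * (L : ℝ) ^ 2 / c2' d L := ⟨_, rfl⟩
  obtain ⟨E3, hE3⟩ : ∃ E3 : ℝ, E3 = 40 * cc * (L : ℝ) ^ 2 := ⟨_, rfl⟩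
  obtain ⟨E4, hE4⟩ : ∃ E4 : ℝ, E4 = 16 * C₁ * L * K₁ := ⟨_, rfl⟩
  obtain ⟨E5, hE5⟩ : ∃ E5 : ℝ, E5 = (2 + 32 * C₁ * (L : ℝ) ^ 2) * K₁ ^ 2 + 20 * d * K₁ := ⟨_, rfl⟩
  have g1 : 0 ≤ E1 := by rw [hE1]; positivity
  have g2 : 0 ≤ E2 := by rw [hE2]; positivity
  have g3 : 0 ≤ E3 := by rw [hE3]; positivity
  have g4 : 0 ≤ E4 := by rw [hE4]; positivity
  have g5 : 0 ≤ E5 := by rw [hE5]; positivity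
  have tpos : ∀ {D : ℝ}, 0 ≤ D → 0 < 1 / (D + 1) := fun h => by positivity
  obtain ⟨a, ha⟩ : ∃ a : ℝ, a = min (1 / (E1 + 1)) (min (1 / (E2 + 1)) (min (1 / (E3 + 1)) (min (1 / (E4 + 1)) (1 / (E5 + 1))))) :=
    ⟨_, rfl⟩
  have ha0 : 0 < a := by
    rw [ha]
    exact lt_min (tpos g1) (lt_min (tpos g2) (lt_min (tpos g3) (lt_min (tpos g4) (tpos g5))))
  refine ⟨a, ha0, ?_⟩
  intro α₀ α₁ hα₀ hα₁ hguard cs cB hcs hcB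
  obtain ⟨S, hSdef⟩ : ∃ S : ℝ, S = α₀ + α₁ := ⟨_, rfl⟩
  have hS0 : 0 < S := by rw [hSdef]; linarith only [hα₀, hα₁]
  have hSa : S ≤ a := by rw [hSdef]; exact hguard
  have hα₀S : α₀ ≤ S := by rw [hSdef]; linarith only [hα₁]
  have dev : ∀ {D : ℝ}, 0 ≤ D → a ≤ 1 / (D + 1) → D * S ≤ 1 := fun {D} hD h => by
    have hD1 : 0 < D + 1 := by linarith only [hD]
    have h1 : D * S ≤ D * a := mul_le_mul_of_nonneg_left hSa hD
    have h2 : D * a ≤ D * (1 / (D + 1)) := mul_le_mul_of_nonneg_left h hD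
    have h3 : D * (1 / (D + 1)) ≤ 1 := by
      rw [mul_one_div, div_le_one hD1]; linarith only
    linarith only [h1, h2, h3]
  have ha' : a ≤ min (1 / (E1 + 1)) (min (1 / (E2 + 1)) (min (1 / (E3 + 1)) (min (1 / (E4 + 1)) (1 / (E5 + 1))))) := le_of_eq ha
  have f1 : E1 * S ≤ 1 := dev g1 (ha'.trans (min_le_left _ _))
  have hb2 := ha'.trans (min_le_right _ _)
  have f2 : E2 * S ≤ 1 := dev g2 (hb2.trans (min_le_left _ _))
  have hb3 := hb2.trans (min_le_right _ _)
  have f3 : E3 * S ≤ 1 := dev g3 (hb3.trans (min_le_left _ _))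
  have hb4 := hb3.trans (min_le_right _ _)
  have f4 : E4 * S ≤ 1 := dev g4 (hb4.trans (min_le_left _ _))
  have f5 : E5 * S ≤ 1 := dev g5 (hb4.trans (min_le_right _ _))
  rw [hE1] at f1; rw [hE2] at f2; rw [hE3] at f3; rw [hE4] at f4; rw [hE5] at f5
  -- the scales in terms of `S`
  have hcsS : cs = K₁ * S := by rw [hcs, hK₁, hSdef]
  have hcBS : cB = L * K₁ * S := by rw [hcB, hcsS]; ring
  have hcs0 : 0 ≤ cs := by rw [hcsS]; positivity
  have hcB0 : 0 ≤ cB := by rw [hcBS]; positivity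
  have hL2 : (0 : ℝ) < (L : ℝ) ^ 2 := by positivity
  have hL2α₀ : (L : ℝ) ^ 2 * α₀ ≤ (L : ℝ) ^ 2 * S := mul_le_mul_of_nonneg_left hα₀S hL2.le
  refine ⟨?_, ?_, ?_, ?_, ?_⟩
  · -- `C₀·L²α₀ ≤ 1/3`
    have h1 : C0 d * ((L : ℝ) ^ 2 * α₀) ≤ C0 d * ((L : ℝ) ^ 2 * S) := mul_le_mul_of_nonneg_left hL2α₀ hC0.le
    have e : C0 d * ((L : ℝ) ^ 2 * S) = (3 * C0 d * (L : ℝ) ^ 2 * S) / 3 := by ring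
    rw [e] at h1
    linarith only [h1, f1]
  · -- `4L²α₀ ≤ c₂′`
    have h1 : 4 * (L : ℝ) ^ 2 / c2' d L * S ≤ 1 := f2
    rw [div_mul_eq_mul_div, div_le_one hc2] at h1
    nlinarith only [h1, hL2α₀]
  · -- `e^{4c·L²α₀}(1 + 8C₁c_B) ≤ 2`
    have hx0 : 0 ≤ 4 * (800 * ((d : ℝ) + 1) ^ 2 * ((d : ℝ) + 4)) * ((L : ℝ) ^ 2 * α₀) := by positivity
    have hx : 4 * (800 * ((d : ℝ) + 1) ^ 2 * ((d : ℝ) + 4)) * ((L : ℝ) ^ 2 * α₀) ≤ 1 / 10 := by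
      rw [← hcc]
      have h1 : 4 * cc * ((L : ℝ) ^ 2 * α₀) ≤ 4 * cc * ((L : ℝ) ^ 2 * S) := mul_le_mul_of_nonneg_left hL2α₀ (by positivity)
      have e : 4 * cc * ((L : ℝ) ^ 2 * S) = (40 * cc * (L : ℝ) ^ 2 * S) / 10 := by ring
      rw [e] at h1
      linarith only [h1, f3]
    have hy0 : 0 ≤ 8 * (131072 * ((d : ℝ) + 1) ^ 2) * cB := by positivity
    have hy : 8 * (131072 * ((d : ℝ) + 1) ^ 2) * cB ≤ 1 / 2 := by
      rw [← hC₁, hcBS]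
      have e : 8 * C₁ * (L * K₁ * S) = (16 * C₁ * L * K₁ * S) / 2 := by ring
      rw [e]
      linarith only [f4]
    exact (exp_window' hx0 hx hy0 hy).1
  · -- `8C₁e^{4c·L²α₀}L² ≤ 16C₁L²`
    have hx0 : 0 ≤ 4 * (800 * ((d : ℝ) + 1) ^ 2 * ((d : ℝ) + 4)) * ((L : ℝ) ^ 2 * α₀) := by positivity
    have hx : 4 * (800 * ((d : ℝ) + 1) ^ 2 * ((d : ℝ) + 4)) * ((L : ℝ) ^ 2 * α₀) ≤ 1 / 10 := by
      rw [← hcc]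
      have h1 : 4 * cc * ((L : ℝ) ^ 2 * α₀) ≤ 4 * cc * ((L : ℝ) ^ 2 * S) := mul_le_mul_of_nonneg_left hL2α₀ (by positivity)
      have e : 4 * cc * ((L : ℝ) ^ 2 * S) = (40 * cc * (L : ℝ) ^ 2 * S) / 10 := by ring
      rw [e] at h1
      linarith only [h1, f3]
    have hE2 := (exp_window' hx0 hx le_rfl (by norm_num : (0 : ℝ) ≤ 1 / 2)).2
    have hK : 0 ≤ 8 * (131072 * ((d : ℝ) + 1) ^ 2) * (L : ℝ) ^ 2 := by positivity
    calc 8 * (131072 * ((d : ℝ) + 1) ^ 2) * Real.exp (4 * (800 * ((d : ℝ) + 1) ^ 2 * ((d : ℝ) + 4)) * ((L : ℝ) ^ 2 * α₀)) * (L : ℝ) ^ 2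
        = (8 * (131072 * ((d : ℝ) + 1) ^ 2) * (L : ℝ) ^ 2)
            * Real.exp (4 * (800 * ((d : ℝ) + 1) ^ 2 * ((d : ℝ) + 4)) * ((L : ℝ) ^ 2 * α₀)) := by ring
      _ ≤ (8 * (131072 * ((d : ℝ) + 1) ^ 2) * (L : ℝ) ^ 2) * 2 := mul_le_mul_of_nonneg_left hE2 hK
      _ = 16 * (131072 * ((d : ℝ) + 1) ^ 2) * (L : ℝ) ^ 2 := by ring
  · -- (1.61) with `C₂ = 16C₁L²`: `2c⋆² + 20dα₀c⋆ + 2(16C₁L²)c⋆² ≤ α₀ + α₁`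
    rw [← hSdef, ← hC₁, hcsS]
    have h20 : 20 * d * α₀ * (K₁ * S) ≤ 20 * d * K₁ * S ^ 2 := by
      have h1 : 20 * d * α₀ * (K₁ * S) = (20 * d * K₁ * S) * α₀ := by ring
      have h2 : 20 * d * K₁ * S ^ 2 = (20 * d * K₁ * S) * S := by ring
      rw [h1, h2]
      exact mul_le_mul_of_nonneg_left hα₀S (by positivity)
    have hsum : 2 * (K₁ * S) ^ 2 + 20 * d * α₀ * (K₁ * S) + 2 * (16 * C₁ * (L : ℝ) ^ 2) * (K₁ * S) ^ 2
        ≤ ((2 + 32 * C₁ * (L : ℝ) ^ 2) * K₁ ^ 2 + 20 * d * K₁) * S * S := by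
      have e : ((2 + 32 * C₁ * (L : ℝ) ^ 2) * K₁ ^ 2 + 20 * d * K₁) * S * S
          = 2 * (K₁ * S) ^ 2 + 20 * d * K₁ * S ^ 2 + 2 * (16 * C₁ * (L : ℝ) ^ 2) * (K₁ * S) ^ 2 := by ring
      rw [e]
      linarith only [h20]
    have hfin : ((2 + 32 * C₁ * (L : ℝ) ^ 2) * K₁ ^ 2 + 20 * d * K₁) * S * S ≤ 1 * S :=
      mul_le_mul_of_nonneg_right f5 hS0.le
    linarith only [hsum, hfin]

/-! ## §2 The γ socket at one member from the guarded uniqueness-letters family -/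

section OneMember

variable {L : ℕ} {η : ℝ} {k : ℕ} {Ω : ℕ → Set (Site d)} {Λs : ℕ → ℕ → Set (Site d)} {Λb : ℕ → ℕ → Set (Site d × Fin d)}
  {B₀ B₀'H B₂' BG BR cB9 cL cP cu α₄ B₀β β : ℝ} {len : Site d → ℝ}

/-- ★ **`SockP5uEγ` AT ONE MEMBER FROM THE GUARDED UNIQUENESS-LETTERS FAMILY AND THE b9 SOCKET OVER PRINT's CLASS** — dag-n05-d's
`B8SockP5uEAssemblyB.sockP5uE_of_lettersUB` VERBATIM except: the member's constraint-bond classes `Λb m j` read by the b9 socket obey print's law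
«box ⊂ Ω_{j−1}» (`hbox`; (1.31) p. 82), a second windows family `hwinγ` below `c_P` supplies the five γ windows of §1 (`gammaWindows_of_guard`), the body is
`B8SockP5uEAssemblyBGamma.sockP5uE_body_of_join_b_γ`, and the conclusion is the γ socket text `B8LeafModelZdSockP5uEGamma.SockP5uEγ` ((1.35) in print's
p. 77 guard).  (i) letters `SLetUB` at the top structure, (ii) `SB9all` at every truncation (the top one is read), (iii) dag-n04-b's 29-window family `hwin`
at the fixed radius `α₄` and socket radius `c_u` — unchanged.
[cite: Balaban1985RegularSpaces, Prop. 5 (1.109) p.94, Thm 4 p.88, p.95, (1.31) + (1.35) p.82, p.77; Balaban1985BackgroundPropagators, Thm 3.1 p.397, Thm 3.3 p.398] -/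
theorem sockP5uEγ_of_lettersUB (hd2 : 2 ≤ d) (hL : 2 ≤ L) (hη : 0 < η) (hk : 1 ≤ k) (hΩ : ∀ j, Ω (j + 1) ⊆ Ω j) (hΩ0 : Ω 0 = Set.univ)
    (hbox : ∀ m, m ≤ k → ∀ j, j ≤ m → ∀ c ∈ Λb m j, ∀ x, InBox (loK L j c.1) (bondHiK L j c.1 c.2) x → x ∈ Ω (j - 1))
    (hclass : ∀ m, m ≤ k → ∀ j, j ≤ m → ∀ c ∈ Λb m j,
      (c.1 ∈ Λs m j ∧ c.1 + e c.2 ∈ Λs m j) ∨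
      (∃ j', j = j' + 1 ∧ (∀ x, (L : ℤ) • c.1 ≤ x → x ≤ (L : ℤ) • c.1 + blockTop L → x ∈ Λs m j') ∧ c.1 + e c.2 ∈ Λs m j) ∨
      (∃ j', j = j' + 1 ∧ c.1 ∈ Λs m j ∧ (∀ x, (L : ℤ) • (c.1 + e c.2) ≤ x → x ≤ (L : ℤ) • (c.1 + e c.2) + blockTop L → x ∈ Λs m j')))
    (htower : ∀ j, j ≤ k → ∀ y ∈ Λs k j, ∀ x, InBox (tlo L y j) (thi L y j) x → x ∈ Ω j)
    (hB₀ : 0 < B₀) (hB₀'H : 0 < B₀'H) (hB₂' : 0 ≤ B₂') (hBG : 0 ≤ BG) (hBR : 0 ≤ BR) (hα₄ : 0 < α₄)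
    -- (i) the uniqueness-letters family at the top structure `(k, Λs k)`
    (SLetUB : ∀ α₀ : ℝ, 0 < α₀ → α₀ ≤ cL → ∀ U₀ : Site d → Fin d → 𝔸ˣ, (∀ x κ, U₀ x κ ∈ unitaryUnits 𝔸) → InAk L k η α₀ Ω U₀ →
      ∃ (g Δ : (Site d → 𝔸) →ₗ[ℂ] (Site d → 𝔸)) (q : (Site d → 𝔸) →ₗ[ℂ] (ℕ → Site d → 𝔸)) (qs : (ℕ → Site d → 𝔸) →ₗ[ℂ] (Site d → 𝔸))
        (Aw c : (ℕ → Site d → 𝔸) →ₗ[ℂ] (ℕ → Site d → 𝔸)) (H' : XSpace d k 𝔸 →ₗ[ℂ] (Site d → 𝔸)),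
        (∀ x : Site d → 𝔸, (∃ C : ℝ, ∀ y, ‖x y‖ ≤ C) → g (Δ x + qs (Aw (q x))) = x) ∧ (∀ φ, qs (c (q (g (g (qs φ))))) = qs φ) ∧
        (∀ (f : Site d → 𝔸), ∀ x ∈ Ω 0, Δ f x = covLap η U₀ ((Ω 0).indicator f) x) ∧
        (∀ (μ : ℕ → Site d → 𝔸), ∀ x ∈ Ω 0, qs μ x = QT L k (Λs k) U₀ μ x) ∧
        (∀ (f : Site d → 𝔸) (j : ℕ), j ≤ k → ∀ y ∈ Λs k j, q f j y = QprimeIter (zdBlocking d L) (bgT L U₀) j f y) ∧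
        (∀ (f : Site d → 𝔸) (j : ℕ) (y : Site d), ¬ (j ≤ k ∧ y ∈ Λs k j) → q f j y = 0) ∧
        (∀ (X : XSpace d k 𝔸) (x : Site d), ‖H' X x‖ ≤ B₀'H * ‖X‖) ∧
        (∀ j, j ≤ k → ∀ (X : XSpace d k 𝔸), ∀ p ∈ {b : Site d × Fin d | SideTouches (Ω j) b.1 b.2},
          wt L η j * ‖covDerivFwd η U₀ p.2 (H' X) p.1‖ ≤ B₀'H * ‖X‖) ∧
        (∀ X : XSpace d k 𝔸, Bd2 L η k Ω (covLap η U₀ (H' X)) (B₂' * ‖X‖)) ∧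
        (∀ (Y : XSpace d k 𝔸) (j : ℕ) (hj : j ≤ k) (y : Site d), y ∈ Λs k j →
          QprimeIter (zdBlocking d L) (bgT L U₀) j (H' Y) y = Y (⟨j, Nat.lt_succ_of_le hj⟩, y)) ∧
        (∀ (f : Site d → 𝔸) (r : ℝ), 0 ≤ r → Bd2 L η k Ω f r →
          (∀ x, ‖g f x‖ ≤ BG * r) ∧ ∀ j, j ≤ k → ∀ p ∈ {b : Site d × Fin d | SideTouches (Ω j) b.1 b.2},
            wt L η j * ‖covDerivFwd η U₀ p.2 (g f) p.1‖ ≤ BG * r) ∧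
        (∀ (f : Site d → 𝔸) (r : ℝ), 0 ≤ r → Bd2 L η k Ω f r → Bd2 L η k Ω (f - g (qs (c (q (g f))))) (BR * r)))
    -- (ii) the b9 socket at every truncation, over the PARAMETRIC class `Λb` (the top one is read)
    (SB9all : ∀ m, m ≤ k → SockB9P3 (𝔸 := 𝔸) L B₀ B₀β cB9 β len η m Ω Λs Λb) (hcPL : cP ≤ cL)
    -- (iii) dag-n04-b's windows family below `c_P` at the fixed radius `α₄` and socket radius `c_u`
    (hwin : ∀ α₀ α₁ : ℝ, 0 < α₀ → 0 < α₁ → α₀ + α₁ ≤ cP →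
      ∀ cs cB cDA hE hE₂ lE lE₂ : ℝ, cs = 5 * (d : ℝ) * L * B₀ * (α₀ + α₁) → cB = L * cs → cDA = (d : ℝ) * (L : ℝ) ^ 2 * cs →
      hE = B₀'H * (C2p d * (40 * d * cB + α₄) * α₄) → hE₂ = B₂' * (C2p d * (40 * d * cB + α₄) * α₄) →
      lE = B₀'H * (4 * C2p d * (40 * d * cB + 2 * α₄)) → lE₂ = B₂' * (4 * C2p d * (40 * d * cB + 2 * α₄)) →
      36 * d * B₀ * cs ≤ 1 / 2 ∧
      8 * (131072 * ((d : ℝ) + 1) ^ 2) * Real.exp (4 * (800 * ((d : ℝ) + 1) ^ 2 * ((d : ℝ) + 4)) * α₀) ≤ 16 * (131072 * ((d : ℝ) + 1) ^ 2) ∧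
      2 * cs ^ 2 + 20 * d * α₀ * cs + 2 * (16 * (131072 * ((d : ℝ) + 1) ^ 2)) * cs ^ 2 ≤ α₀ + α₁ ∧
      (d : ℝ) * L * α₁ ≤ 1 / 8 ∧
      α₀ ≤ cB9 ∧ cs ≤ cB9 ∧
      C0 d * α₀ ≤ 1 / 3 ∧ 4 * α₀ ≤ c2' d L ∧
      Real.exp (4 * (800 * ((d : ℝ) + 1) ^ 2 * ((d : ℝ) + 4)) * α₀) * (1 + 8 * (131072 * ((d : ℝ) + 1) ^ 2) * cB) ≤ 2 ∧
      2 * cB ≤ c3 d L ∧ 2048 * (d : ℝ) * cB ≤ 1 ∧ 40 * d * cB ≤ 1 / 200 ∧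
      200 * C6 d * (2 * α₄) ≤ 1 ∧ 12000 * ((d : ℝ) + 1) * L * (2 * α₄) ≤ 1 ∧
      C4G d L * (α₀ + 40 * d * cB + 4 * (2 * α₄)) ≤ 1 ∧
      1024 * ((d : ℝ) + 1) * ((d : ℝ) + 4) * L ^ 2 * α₀ ≤ 1 ∧ 32 * ((d : ℝ) + 1) ^ 2 * C6 d * L ^ 2 * α₀ ≤ 1 ∧
      16 * d * C5' d * C6 d * (L : ℝ) ^ 2 * α₀ ≤ 1 ∧ 8 * d * C6 d * L * α₀ ≤ 1 ∧
      40 * d * cB + α₄ ≤ 1 / (4 * B₀'H * (2 * C2p d)) ∧ 2 * C6 d * (40 * d * cB + 4 * α₄) ≤ 1 / 8 ∧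
      cB ≤ 1 / 13 ∧ α₄ / 4 + hE ≤ 1 / 24 ∧ α₄ / 4 + hE ≤ 1 / 140 ∧ 10 * (α₄ / 4 + hE) * BR ≤ 1 / 2 ∧
      BG * Mc d BR (α₄ / 4 + hE) cB hE₂ cDA ≤ α₄ / 4 ∧
      BG * Kc d BR (α₄ / 4 + hE) cB hE₂ cDA lE₂ (1 + lE) (1 + lE) ≤ 1 / 2 ∧
      lE ≤ 1 / 2 ∧ cu + hE ≤ α₄ / 4)
    -- (iv) the γ windows family below `c_P` (§1 `gammaWindows_of_guard` below `c_γ`)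
    (hwinγ : ∀ α₀ α₁ : ℝ, 0 < α₀ → 0 < α₁ → α₀ + α₁ ≤ cP →
      ∀ cs cB : ℝ, cs = 5 * (d : ℝ) * L * B₀ * (α₀ + α₁) → cB = L * cs →
      C0 d * ((L : ℝ) ^ 2 * α₀) ≤ 1 / 3 ∧ 4 * ((L : ℝ) ^ 2 * α₀) ≤ c2' d L ∧
      Real.exp (4 * (800 * ((d : ℝ) + 1) ^ 2 * ((d : ℝ) + 4)) * ((L : ℝ) ^ 2 * α₀)) * (1 + 8 * (131072 * ((d : ℝ) + 1) ^ 2) * cB) ≤ 2 ∧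
      8 * (131072 * ((d : ℝ) + 1) ^ 2) * Real.exp (4 * (800 * ((d : ℝ) + 1) ^ 2 * ((d : ℝ) + 4)) * ((L : ℝ) ^ 2 * α₀)) * (L : ℝ) ^ 2
        ≤ 16 * (131072 * ((d : ℝ) + 1) ^ 2) * (L : ℝ) ^ 2 ∧
      2 * cs ^ 2 + 20 * d * α₀ * cs + 2 * (16 * (131072 * ((d : ℝ) + 1) ^ 2) * (L : ℝ) ^ 2) * cs ^ 2 ≤ α₀ + α₁) :
    SockP5uEγ (𝔸 := 𝔸) L B₀ cP cu η k Ω Λs := by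
  intro α₀ α₁ hα₀ hα₁ hs U₀ U' hU₀ hU' h33 h34 hAx h135 _ u₁ hu₁ _ h129 hLan hdat v w lam mu hv _ hvD hw _ hwD hLv hRv hLw hRw
  -- dag-n04-b's windows at this (α₀, α₁) (its (1.56)-constant line and (1.61) at `C₂ = 16C₁` are superseded by the γ ones)
  obtain ⟨hside, -, -, hsmall₁, hα₀9, hcs9, hα3, hα4, hsmall, hc₃, hsc, hα₃', hs₁, hs₂, hs₃, hs₄, hs₅, hs₆, hs₇, hsm, hprod8, hcA', ha₁',
    hb₁', hθ, h103, h106, hlE, hcu⟩ := hwin α₀ α₁ hα₀ hα₁ hs _ _ _ _ _ _ _ rfl rfl rfl rfl rfl rfl rfl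
  -- the γ windows at this (α₀, α₁)
  obtain ⟨hα3L, hα4L, hsmallL, hC₂L, h61L⟩ := hwinγ α₀ α₁ hα₀ hα₁ hs _ _ rfl rfl
  -- the letters at the top structure
  have hα₀L : α₀ ≤ cL := by linarith
  obtain ⟨g, Δ, q, qs, Aw, c, H', g_leftB, c_left', hΔ, hqs, hq, hq0, hH0, hH1, hH2, hQH, hG, hRbd⟩ := SLetUB α₀ hα₀ hα₀L U₀ hU₀ h33
  exact sockP5uE_body_of_join_b_γ hd2 hL hη hk hΩ hΩ0 hbox hclass htower hα₀ hα₁ hB₀ rfl hα₄ hU₀ hU' h33 h34 hAx h135 hu₁ h129 hLan hdat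
    (SB9all k le_rfl) hα₀9 hcs9 hside hC₂L h61L hsmall₁ g Δ q qs Aw c g_leftB c_left' hΔ hqs hq hq0 H' hB₀'H hB₂' hBG hBR hH0 hH1 hH2 hQH hG
    hRbd le_rfl le_rfl le_rfl hα3 hα4 hα3L hα4L hsmallL hsmall hc₃ hsc hα₃' hs₁ hs₂ hs₃ hs₄ hs₅ hs₆ hs₇ hsm hprod8 rfl rfl rfl rfl hcA' ha₁' hb₁'
    hθ h103 h106 hlE hcu hv hvD hw hwD hLv hRv hLw hRw

end OneMember

/-! ## §3 One socket radius and one threshold for the whole `Ω 0 = univ` sub-family -/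

/-- ★ **THE γ UNIQUENESS SOCKET OF THE N05 KNIT BELOW ONE THRESHOLD, AT ONE RADIUS, FROM THE GUARDED UNIQUENESS-LETTERS FAMILY AND THE b9 SOCKET
OVER PRINT's CLASS** — dag-n05-d's `B8SockP5uEAssemblyB.exists_threshold_sockP5uEB` VERBATIM except: the member's classes `Λb` obey print's law
«box ⊂ Ω_{j−1}», the conclusion is `SockP5uEγ`, and the threshold is `c_F = min(c_P, c_L, c_γ)` with the γ windows' `c_γ(d, L, B₀)` of §1 joined to
dag-n04-b's `c_P` (`uniqWindows_of_guard`) and the letters' `c_L`.  Print's «there exist positive constants c₂, c₃, depending on d and L only».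
[cite: Balaban1985RegularSpaces, Prop. 5 (1.109) p.94 («c₂, c₃»; «largest possible α₄ … independent of α₀ + α₁»), Thm 4 p.88, p.95, (1.31) p.82, p.77; Balaban1985BackgroundPropagators, Thm 3.1 p.397, Thm 3.3 p.398] -/
theorem exists_threshold_sockP5uEγB (hd2 : 2 ≤ d) {L : ℕ} (hL : 2 ≤ L) {B₀ B₀'H B₂' BG BR cB9 cL : ℝ} (hB₀ : 0 < B₀)
    (hB : 2 ≤ 5 * (d : ℝ) * L * B₀) (hB₀'H : 0 < B₀'H) (hB₂' : 0 ≤ B₂') (hBG : 0 ≤ BG) (hBR : 0 ≤ BR) (hcB9 : 0 < cB9) (hcL : 0 < cL) :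
    ∃ cu cF : ℝ, 0 < cu ∧ 0 < cF ∧ ∀ {η : ℝ}, 0 < η → ∀ {k : ℕ}, 1 ≤ k → ∀ {Ω : ℕ → Set (Site d)}, (∀ j, Ω (j + 1) ⊆ Ω j) → Ω 0 = Set.univ →
      ∀ {Λs : ℕ → ℕ → Set (Site d)} {Λb : ℕ → ℕ → Set (Site d × Fin d)},
      (∀ m, m ≤ k → ∀ j, j ≤ m → ∀ c ∈ Λb m j, ∀ x, InBox (loK L j c.1) (bondHiK L j c.1 c.2) x → x ∈ Ω (j - 1)) →
      (∀ m, m ≤ k → ∀ j, j ≤ m → ∀ c ∈ Λb m j,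
        (c.1 ∈ Λs m j ∧ c.1 + e c.2 ∈ Λs m j) ∨
        (∃ j', j = j' + 1 ∧ (∀ x, (L : ℤ) • c.1 ≤ x → x ≤ (L : ℤ) • c.1 + blockTop L → x ∈ Λs m j') ∧ c.1 + e c.2 ∈ Λs m j) ∨
        (∃ j', j = j' + 1 ∧ c.1 ∈ Λs m j ∧ (∀ x, (L : ℤ) • (c.1 + e c.2) ≤ x → x ≤ (L : ℤ) • (c.1 + e c.2) + blockTop L → x ∈ Λs m j'))) →
      (∀ j, j ≤ k → ∀ y ∈ Λs k j, ∀ x, InBox (tlo L y j) (thi L y j) x → x ∈ Ω j) →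
      (∀ α₀ : ℝ, 0 < α₀ → α₀ ≤ cL → ∀ U₀ : Site d → Fin d → 𝔸ˣ, (∀ x κ, U₀ x κ ∈ unitaryUnits 𝔸) → InAk L k η α₀ Ω U₀ →
        ∃ (g Δ : (Site d → 𝔸) →ₗ[ℂ] (Site d → 𝔸)) (q : (Site d → 𝔸) →ₗ[ℂ] (ℕ → Site d → 𝔸)) (qs : (ℕ → Site d → 𝔸) →ₗ[ℂ] (Site d → 𝔸))
          (Aw c : (ℕ → Site d → 𝔸) →ₗ[ℂ] (ℕ → Site d → 𝔸)) (H' : XSpace d k 𝔸 →ₗ[ℂ] (Site d → 𝔸)),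
          (∀ x : Site d → 𝔸, (∃ C : ℝ, ∀ y, ‖x y‖ ≤ C) → g (Δ x + qs (Aw (q x))) = x) ∧ (∀ φ, qs (c (q (g (g (qs φ))))) = qs φ) ∧
          (∀ (f : Site d → 𝔸), ∀ x ∈ Ω 0, Δ f x = covLap η U₀ ((Ω 0).indicator f) x) ∧
          (∀ (μ : ℕ → Site d → 𝔸), ∀ x ∈ Ω 0, qs μ x = QT L k (Λs k) U₀ μ x) ∧
          (∀ (f : Site d → 𝔸) (j : ℕ), j ≤ k → ∀ y ∈ Λs k j, q f j y = QprimeIter (zdBlocking d L) (bgT L U₀) j f y) ∧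
          (∀ (f : Site d → 𝔸) (j : ℕ) (y : Site d), ¬ (j ≤ k ∧ y ∈ Λs k j) → q f j y = 0) ∧
          (∀ (X : XSpace d k 𝔸) (x : Site d), ‖H' X x‖ ≤ B₀'H * ‖X‖) ∧
          (∀ j, j ≤ k → ∀ (X : XSpace d k 𝔸), ∀ p ∈ {b : Site d × Fin d | SideTouches (Ω j) b.1 b.2},
            wt L η j * ‖covDerivFwd η U₀ p.2 (H' X) p.1‖ ≤ B₀'H * ‖X‖) ∧
          (∀ X : XSpace d k 𝔸, Bd2 L η k Ω (covLap η U₀ (H' X)) (B₂' * ‖X‖)) ∧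
          (∀ (Y : XSpace d k 𝔸) (j : ℕ) (hj : j ≤ k) (y : Site d), y ∈ Λs k j →
            QprimeIter (zdBlocking d L) (bgT L U₀) j (H' Y) y = Y (⟨j, Nat.lt_succ_of_le hj⟩, y)) ∧
          (∀ (f : Site d → 𝔸) (r : ℝ), 0 ≤ r → Bd2 L η k Ω f r →
            (∀ x, ‖g f x‖ ≤ BG * r) ∧ ∀ j, j ≤ k → ∀ p ∈ {b : Site d × Fin d | SideTouches (Ω j) b.1 b.2},
              wt L η j * ‖covDerivFwd η U₀ p.2 (g f) p.1‖ ≤ BG * r) ∧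
          (∀ (f : Site d → 𝔸) (r : ℝ), 0 ≤ r → Bd2 L η k Ω f r → Bd2 L η k Ω (f - g (qs (c (q (g f))))) (BR * r))) →
      ∀ {B₀β β : ℝ} {len : Site d → ℝ}, (∀ m, m ≤ k → SockB9P3 (𝔸 := 𝔸) L B₀ B₀β cB9 β len η m Ω Λs Λb) →
        SockP5uEγ (𝔸 := 𝔸) L B₀ cF cu η k Ω Λs := by
  have hd1 : 1 ≤ d := le_trans (by norm_num) hd2
  have hL1 : 1 ≤ L := le_trans (by norm_num) hL
  obtain ⟨α₄, cu, cP, hα₄, hcu, hcP, hwin⟩ := uniqWindows_of_guard hd1 hL1 hB₀ hB hB₀'H hB₂' hBG hBR hcB9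
  obtain ⟨cγ, hcγ, hwinγ⟩ := gammaWindows_of_guard (d := d) hd1 hL1 hB₀
  refine ⟨cu, min cP (min cL cγ), hcu, lt_min hcP (lt_min hcL hcγ), ?_⟩
  intro η hη k hk Ω hΩ hΩ0 Λs Λb hbox hclass htower SLetUB B₀β β len SB9all
  have hwin' : ∀ α₀ α₁ : ℝ, 0 < α₀ → 0 < α₁ → α₀ + α₁ ≤ min cP (min cL cγ) → _ :=
    fun α₀ α₁ hα₀ hα₁ hs' => hwin α₀ α₁ hα₀ hα₁ (hs'.trans (min_le_left _ _))
  have hwinγ' : ∀ α₀ α₁ : ℝ, 0 < α₀ → 0 < α₁ → α₀ + α₁ ≤ min cP (min cL cγ) → _ :=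
    fun α₀ α₁ hα₀ hα₁ hs' => hwinγ α₀ α₁ hα₀ hα₁ (hs'.trans ((min_le_right _ _).trans (min_le_right _ _)))
  exact sockP5uEγ_of_lettersUB hd2 hL hη hk hΩ hΩ0 hbox hclass htower hB₀ hB₀'H hB₂' hBG hBR hα₄ SLetUB SB9all
    ((min_le_right _ _).trans (min_le_left _ _)) hwin' hwinγ'

#print axioms gammaWindows_of_guard
#print axioms sockP5uEγ_of_lettersUB
#print axioms exists_threshold_sockP5uEγB

end Literature.MathematicalPhysics.QuantumFieldTheory.Balaban1983to89.B8SockP5uEProviderGamma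

end
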